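import Literature.Computability.Cryptography.LWEHybridT2Law
import Literature.Computability.Cryptography.LWEShiftDimProg
import HarnessLib

/-!
# Hybrid `ℬ₂`'s transformation as a typed polynomial-time program, and its law on uniform coins

Topic `Computability/Cryptography` (LWE), grouping namespace `BLPRS2013.KProg`; sequel of `LWEHybridT2Law.lean` (`machHybT2`: the machine's law — columns of `C` from
residues, noise coordinates from the rejection sampler at centre `0`) and of `LWEShiftDimProg.lean`/`LWESelfTestSamplerProg.lean` (`wordsOf`, `dotMod`, the coin
plumbing), using the rejection sampler PROGRAM of `RejectionSamplerMachine.lean` (`GaussRejMachine.rejFlat`/`rejOf`, `uniformVector_map_rejFlat`). This file writes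
`(aᵢ, bᵢ)ᵢ ↦ (Cᵀaᵢ + ēᵢ mod Q, bᵢ)ᵢ` as a deterministic function of a flat coin string, in closed form and as a program against a record, proves the program typed
polynomial time, and identifies its law on uniform coins with `machHybT2` read through `LWE.MP12.Prog.toItem` (everything PROVED; definitions with bodies; no named fact):

* `dotModZ`, `noiseFlat`, `colsFlat`, `hybT2Item`, **`hybT2Flat Q L n k θ s N P w R items coins`** (columns from the first `n·kL` coins, then item `i` with the `i`-th
  chunk of width `n·R(w+1+P)` for its `n` noise coordinates);
* `HRec`/`hRecOf`, `noiseOf`, `colsOf`, `hybT2Of` (the program), `hybT2Of_hRecOf`, `dotModZ_codeFP`, `noiseOf_codeFP`, `colsOf_codeFP`, **`hybT2Of_codeFP`**;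
* `dotModZ_encT`, `colsFlat_append_left`, `colsFlat_eq_ofFn`, `uniformVector_map_colsFlat`, `uniformVector_map_noiseFlat`, `hybT2Item_eq_toItem`,
  **`uniformVector_map_hybT2Flat`** (`= (machHybT2 …).map (items)` for
  `n·kL + M·n·R(w+1+P) ≤ C`).

## References

* Z. Brakerski, A. Langlois, C. Peikert, O. Regev, D. Stehlé, *Classical hardness of learning with errors*, STOC 2013; arXiv:1306.0281, Lemma 4.9 (proof, `ℬ₂`:
  "`H₃, H₄` can be computed efficiently") and §5. [BrakerskiEtAl2013]
* C. Gentry, C. Peikert, V. Vaikuntanathan, *Trapdoors for hard lattices…*, STOC 2008, §4.1. [GentryPeikertVaikuntanathan2008]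
* S. Arora, B. Barak, *Computational Complexity: A Modern Approach*, CUP 2009, §1.3, Def. 7.1. [AroraBarak2009]
-/

noncomputable section

open scoped ENNReal
open PMF Literature.Probability.Distributions Literature.Algebra.EuclideanLattices

namespace Literature.Computability.Cryptography

namespace BLPRS2013

namespace KProg

open Literature.Computability.Complexity Literature.Computability.Complexity.CodeFP Literature.Computability.QuantumComplexity
  GaussRejMachine LWE LWE.MP12 LWE.MP12.Prog Matrix
open Literature.Algebra.EuclideanLattices (encodeRat encodeRat_injective)

/-! ### Closed forms -/

/-- `(⟨col, a⟩ + e) mod Q` with an INTEGER `e` (the noise coordinate may be negative). [cite: BrakerskiEtAl2013, Lemma 4.9 (proof, ℬ₂)] -/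
def dotModZ (Q : ℕ) (col a : List ℕ) (e : ℤ) : ℕ :=
  (((List.zipWith (fun x y : ℕ => ((x * y : ℕ) : ℤ)) col a).sum + e) % (Q : ℤ)).toNat

/-- **The `n` noise coordinates of one item**: the rejection sampler (centre `0`) on `n` chunks of width `R(w+1+P)`. [cite: GentryPeikertVaikuntanathan2008, §4.1] -/
def noiseFlat (θ : ℚ) (s N P w R n : ℕ) (coins : List Bool) : List ℤ :=
  ((List.range n).map fun j => (coins.drop (j * (R * (w + 1 + P)))).take (R * (w + 1 + P))).map (rejFlat θ 0 s N P w R)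

/-- **The columns of `C`**: column `j` is `k` residues from the `j`-th block of `kL` coins. [cite: BrakerskiEtAl2013, Lemma 4.9 (proof, ℬ₂)] -/
def colsFlat (Q L n k : ℕ) (coins : List Bool) : List (List ℕ) :=
  ((List.range n).map fun j => (coins.drop (j * (k * L))).take (k * L)).map (wordsOf Q L k)

/-- One transformed item: `(Cᵀa + ē mod Q, b)`. [cite: BrakerskiEtAl2013, Lemma 4.9 (proof, ℬ₂)] -/
def hybT2Item (Q : ℕ) (cols : List (List ℕ)) (it : LItem) (es : List ℤ) : LItem :=
  (List.zipWith (fun col e => dotModZ Q col it.1 e) cols es, it.2)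

/-- **The transformed tuple from coins**: columns from the first `n·kL` coins, then item `i` with its own chunk of width `n·R(w+1+P)`.
[cite: BrakerskiEtAl2013, Lemma 4.9 (proof, ℬ₂) and §5] -/
def hybT2Flat (Q L n k : ℕ) (θ : ℚ) (s N P w R : ℕ) (items : List LItem) (coins : List Bool) : List LItem :=
  let cols := colsFlat Q L n k coins
  let rest := coins.drop (n * (k * L))
  let W := n * (R * (w + 1 + P))
  List.zipWith (fun it ci => hybT2Item Q cols it (noiseFlat θ s N P w R n ci)) items ((List.range items.length).map fun i => (rest.drop (i * W)).take W)

/-! ### Record and program -/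

/-- **The record**: `((Q, (L, (n, k))), rejection-sampler context)` (`L, n, k` unary). [folklore] -/
abbrev HRec : Type := (ℕ × (ℕ × (ℕ × ℕ))) × RejCtx

/-- Its code. [folklore] -/
abbrev hRecE : HRec → List Bool := pairE (pairE natE (pairE unE (pairE unE unE))) rejCtxE

/-- The genuine record. [folklore] -/
def hRecOf (Q L n k : ℕ) (θ : ℚ) (s N P w R : ℕ) : HRec := ((Q, (L, (n, k))), rejCtxOf θ 0 s N P w R)

/-- The chunk width `R(w+1+P)` read off the sampler context. [folklore] -/
def noiseWidth (r : RejCtx) : ℕ := r.2.2 * (r.2.1 + 1 + r.1.2.2.2.2.1)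

/-- The noise coordinates against the record. [folklore] -/
def noiseOf (r : RejCtx) (n : ℕ) (coins : List Bool) : List ℤ :=
  ((List.range n).map fun j => (coins.drop (j * noiseWidth r)).take (noiseWidth r)).map (rejOf r)

/-- The columns against the record. [folklore] -/
def colsOf (Q L n k : ℕ) (coins : List Bool) : List (List ℕ) :=
  ((List.range n).map fun j => (coins.drop (j * (k * L))).take (k * L)).map (wordsOf Q L k)

/-- **The transformation against the record.** [cite: BrakerskiEtAl2013, Lemma 4.9 (proof, ℬ₂)] -/
def hybT2Of (r : HRec) (x : List LItem × List Bool) : List LItem :=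
  let cols := colsOf r.1.1 r.1.2.1 r.1.2.2.1 r.1.2.2.2 x.2
  let rest := x.2.drop (min (r.1.2.2.1 * (r.1.2.2.2 * r.1.2.1)) x.2.length)
  let W := r.1.2.2.1 * noiseWidth r.2
  List.zipWith (fun it ci => hybT2Item r.1.1 cols it (noiseOf r.2 r.1.2.2.1 ci)) x.1 ((List.range x.1.length).map fun i => (rest.drop (i * W)).take W)

/-- At the genuine context the noise program is `noiseFlat`. [folklore] -/
theorem noiseOf_rejCtxOf (θ : ℚ) (s N P w R n : ℕ) (coins : List Bool) : noiseOf (rejCtxOf θ 0 s N P w R) n coins = noiseFlat θ s N P w R n coins := by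
  unfold noiseOf noiseFlat
  have hW : noiseWidth (rejCtxOf θ 0 s N P w R) = R * (w + 1 + P) := rfl
  rw [hW]
  exact List.map_congr_left fun ch _ => rejOf_rejCtxOf θ 0 s N P w R ch

/-- At the genuine record the program is the closed form. [folklore] -/
theorem hybT2Of_hRecOf (Q L n k : ℕ) (θ : ℚ) (s N P w R : ℕ) (items : List LItem) (coins : List Bool) :
    hybT2Of (hRecOf Q L n k θ s N P w R) (items, coins) = hybT2Flat Q L n k θ s N P w R items coins := by
  unfold hybT2Of hybT2Flat
  simp only [show (hRecOf Q L n k θ s N P w R).1.1 = Q from rfl, show (hRecOf Q L n k θ s N P w R).1.2.1 = L from rfl,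
    show (hRecOf Q L n k θ s N P w R).1.2.2.1 = n from rfl, show (hRecOf Q L n k θ s N P w R).1.2.2.2 = k from rfl,
    show (hRecOf Q L n k θ s N P w R).2 = rejCtxOf θ 0 s N P w R from rfl, noiseOf_rejCtxOf, drop_min_length]
  rfl

/-! ### Typed polynomial time -/

section CodeFP

/-- `dotModZ` is typed polynomial time in `(Q, (col, (a, e)))`. [cite: AroraBarak2009, §1.3] -/
theorem dotModZ_codeFP : CodeFP (pairE natE (pairE (rawE natE) (pairE (rawE natE) intE))) natE (fun p => dotModZ p.1 p.2.1 p.2.2.1 p.2.2.2) := by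
  have hQ : CodeFP (pairE natE (pairE (rawE natE) (pairE (rawE natE) intE))) intE (fun p => (p.1 : ℤ)) := (intOfNat.comp (fst _ _) :)
  have ha : CodeFP (pairE natE (pairE (rawE natE) (pairE (rawE natE) intE))) (rawE natE) (fun p => p.2.1) := (snd _ _).fst'
  have hs : CodeFP (pairE natE (pairE (rawE natE) (pairE (rawE natE) intE))) (rawE natE) (fun p => p.2.2.1) := (snd _ _).snd'.fst'
  have he : CodeFP (pairE natE (pairE (rawE natE) (pairE (rawE natE) intE))) intE (fun p => p.2.2.2) := (snd _ _).snd'.snd'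
  have hprodStep : CodeFP (pairE (pairE natE (pairE (rawE natE) (pairE (rawE natE) intE))) (pairE natE natE)) intE (fun t => ((t.2.1 * t.2.2 : ℕ) : ℤ)) :=
    (intOfNat.comp (natMul.comp ((snd _ _).fst'.pair (snd _ _).snd')) :)
  have hsum : CodeFP (pairE natE (pairE (rawE natE) (pairE (rawE natE) intE))) intE
      (fun p => (List.zipWith (fun x y : ℕ => ((x * y : ℕ) : ℤ)) p.2.1 p.2.2.1).sum + p.2.2.2) :=
    (intAdd.comp ((intSum.comp ((zipWith hprodStep).comp ((CodeFP.id _).pair (ha.pair hs)))).pair he) :)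
  have hmod : CodeFP (pairE natE (pairE (rawE natE) (pairE (rawE natE) intE))) intE
      (fun p => ((List.zipWith (fun x y : ℕ => ((x * y : ℕ) : ℤ)) p.2.1 p.2.2.1).sum + p.2.2.2) % (p.1 : ℤ)) :=
    ((intSub.comp (hsum.pair (intMul.comp (hQ.pair (intEDiv.comp (hsum.pair hQ)))))).congr fun p => by rw [Int.emod_def])
  exact ((intToNat.comp hmod).congr fun p => rfl)

/-- The noise coordinates are typed polynomial time in `((context, n), coins)`. [cite: GentryPeikertVaikuntanathan2008, §4.1; AroraBarak2009, §1.3] -/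
theorem noiseOf_codeFP : CodeFP (pairE (pairE rejCtxE unE) strE) (rawE intE) (fun p => noiseOf p.1.1 p.1.2 p.2) := by
  have hr : CodeFP (pairE (pairE rejCtxE unE) strE) rejCtxE (fun p => p.1.1) := (fst _ _).fst'
  have hn : CodeFP (pairE (pairE rejCtxE unE) strE) unE (fun p => p.1.2) := (fst _ _).snd'
  have hc : CodeFP (pairE (pairE rejCtxE unE) strE) strE (fun p => p.2) := snd _ _
  have hW : CodeFP (pairE (pairE rejCtxE unE) strE) unE (fun p => noiseWidth p.1.1) :=
    (unMul_codeFP.comp (hr.snd'.snd'.pair (unAdd.comp ((unSucc.comp hr.snd'.fst').pair hr.fst'.snd'.snd'.snd'.snd'.fst')))).congr fun p => by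
      simp [noiseWidth]
  have hchunks : CodeFP (pairE (pairE rejCtxE unE) strE) (rawE strE) (fun p => (List.range p.1.2).map fun j => (p.2.drop (j * noiseWidth p.1.1)).take (noiseWidth p.1.1)) :=
    (strChunks.comp (hn.pair (hW.pair hc)) :)
  have hstep : CodeFP (pairE (pairE (pairE rejCtxE unE) strE) strE) intE (fun t => rejOf t.1.1.1 t.2) := (rejOf_codeFP.comp ((fst _ _).fst'.fst'.pair (snd _ _)) :)
  exact (((map hstep).comp ((CodeFP.id _).pair hchunks)).congr fun p => rfl)

/-- The columns are typed polynomial time in `((Q, (L, (n, k))), coins)`. [cite: AroraBarak2009, §1.3] -/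
theorem colsOf_codeFP : CodeFP (pairE (pairE natE (pairE unE (pairE unE unE))) strE) (rawE (rawE natE)) (fun p => colsOf p.1.1 p.1.2.1 p.1.2.2.1 p.1.2.2.2 p.2) := by
  have hQ : CodeFP (pairE (pairE natE (pairE unE (pairE unE unE))) strE) natE (fun p => p.1.1) := (fst _ _).fst'
  have hL : CodeFP (pairE (pairE natE (pairE unE (pairE unE unE))) strE) unE (fun p => p.1.2.1) := (fst _ _).snd'.fst'
  have hn : CodeFP (pairE (pairE natE (pairE unE (pairE unE unE))) strE) unE (fun p => p.1.2.2.1) := (fst _ _).snd'.snd'.fst'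
  have hk : CodeFP (pairE (pairE natE (pairE unE (pairE unE unE))) strE) unE (fun p => p.1.2.2.2) := (fst _ _).snd'.snd'.snd'
  have hc : CodeFP (pairE (pairE natE (pairE unE (pairE unE unE))) strE) strE (fun p => p.2) := snd _ _
  have hkL : CodeFP (pairE (pairE natE (pairE unE (pairE unE unE))) strE) unE (fun p => p.1.2.2.2 * p.1.2.1) := (unMul_codeFP.comp (hk.pair hL) :)
  have hchunks : CodeFP (pairE (pairE natE (pairE unE (pairE unE unE))) strE) (rawE strE)
      (fun p => (List.range p.1.2.2.1).map fun j => (p.2.drop (j * (p.1.2.2.2 * p.1.2.1))).take (p.1.2.2.2 * p.1.2.1)) :=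
    (strChunks.comp (hn.pair (hkL.pair hc)) :)
  have hstep : CodeFP (pairE (pairE (pairE natE (pairE unE (pairE unE unE))) strE) strE) (rawE natE) (fun t => wordsOf t.1.1.1 t.1.1.2.1 t.1.1.2.2.2 t.2) :=
    (wordsOf_codeFP.comp (((fst _ _).fst'.fst'.pair ((fst _ _).fst'.snd'.fst'.pair (fst _ _).fst'.snd'.snd'.snd')).pair (snd _ _)) :)
  exact (((map hstep).comp ((CodeFP.id _).pair hchunks)).congr fun p => rfl)

/-- One transformed item is typed polynomial time in `((Q, cols), (item, es))`. [cite: AroraBarak2009, §1.3] -/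
theorem hybT2Item_codeFP : CodeFP (pairE (pairE natE (rawE (rawE natE))) (pairE itemRawE (rawE intE))) itemRawE (fun p => hybT2Item p.1.1 p.1.2 p.2.1 p.2.2) := by
  have hQ : CodeFP (pairE (pairE natE (rawE (rawE natE))) (pairE itemRawE (rawE intE))) natE (fun p => p.1.1) := (fst _ _).fst'
  have hcols : CodeFP (pairE (pairE natE (rawE (rawE natE))) (pairE itemRawE (rawE intE))) (rawE (rawE natE)) (fun p => p.1.2) := (fst _ _).snd'
  have ha : CodeFP (pairE (pairE natE (rawE (rawE natE))) (pairE itemRawE (rawE intE))) (rawE natE) (fun p => p.2.1.1) := (snd _ _).fst'.fst'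
  have hb : CodeFP (pairE (pairE natE (rawE (rawE natE))) (pairE itemRawE (rawE intE))) natE (fun p => p.2.1.2) := (snd _ _).fst'.snd'
  have hes : CodeFP (pairE (pairE natE (rawE (rawE natE))) (pairE itemRawE (rawE intE))) (rawE intE) (fun p => p.2.2) := (snd _ _).snd'
  -- the step with context `(Q, a)`
  have hstep : CodeFP (pairE (pairE natE (rawE natE)) (pairE (rawE natE) intE)) natE (fun t => dotModZ t.1.1 t.2.1 t.1.2 t.2.2) :=
    (dotModZ_codeFP.comp ((fst _ _).fst'.pair ((snd _ _).fst'.pair ((fst _ _).snd'.pair (snd _ _).snd'))) :)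
  exact ((((zipWith hstep).comp ((hQ.pair ha).pair (hcols.pair hes))).pair hb).congr fun p => rfl)

/-- **The transformation is typed polynomial time** in `(record, (items, coins))`. [cite: BrakerskiEtAl2013, §5; AroraBarak2009, §1.3] -/
theorem hybT2Of_codeFP : CodeFP (pairE hRecE (pairE (rawE itemRawE) strE)) (rawE itemRawE) (fun p => hybT2Of p.1 p.2) := by
  have hr : CodeFP (pairE hRecE (pairE (rawE itemRawE) strE)) hRecE (fun p => p.1) := fst _ _
  have hits : CodeFP (pairE hRecE (pairE (rawE itemRawE) strE)) (rawE itemRawE) (fun p => p.2.1) := (snd _ _).fst'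
  have hc : CodeFP (pairE hRecE (pairE (rawE itemRawE) strE)) strE (fun p => p.2.2) := (snd _ _).snd'
  have hQ : CodeFP (pairE hRecE (pairE (rawE itemRawE) strE)) natE (fun p => p.1.1.1) := hr.fst'.fst'
  have hL : CodeFP (pairE hRecE (pairE (rawE itemRawE) strE)) unE (fun p => p.1.1.2.1) := hr.fst'.snd'.fst'
  have hn : CodeFP (pairE hRecE (pairE (rawE itemRawE) strE)) unE (fun p => p.1.1.2.2.1) := hr.fst'.snd'.snd'.fst'
  have hk : CodeFP (pairE hRecE (pairE (rawE itemRawE) strE)) unE (fun p => p.1.1.2.2.2) := hr.fst'.snd'.snd'.snd'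
  have hctx : CodeFP (pairE hRecE (pairE (rawE itemRawE) strE)) rejCtxE (fun p => p.1.2) := hr.snd'
  have hcols : CodeFP (pairE hRecE (pairE (rawE itemRawE) strE)) (rawE (rawE natE)) (fun p => colsOf p.1.1.1 p.1.1.2.1 p.1.1.2.2.1 p.1.1.2.2.2 p.2.2) :=
    (colsOf_codeFP.comp (hr.fst'.pair hc) :)
  have hoff : CodeFP (pairE hRecE (pairE (rawE itemRawE) strE)) unE (fun p => min (p.1.1.2.2.1 * (p.1.1.2.2.2 * p.1.1.2.1)) p.2.2.length) :=
    (unOfNatMin.comp ((strLength.comp hc).pair (natMul.comp ((natOfUn.comp hn).pair (natMul.comp ((natOfUn.comp hk).pair (natOfUn.comp hL)))))) :)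
  have hrest : CodeFP (pairE hRecE (pairE (rawE itemRawE) strE)) strE (fun p => p.2.2.drop (min (p.1.1.2.2.1 * (p.1.1.2.2.2 * p.1.1.2.1)) p.2.2.length)) :=
    (strDrop.comp (hoff.pair hc) :)
  have hWn : CodeFP (pairE hRecE (pairE (rawE itemRawE) strE)) unE (fun p => noiseWidth p.1.2) :=
    (unMul_codeFP.comp (hctx.snd'.snd'.pair (unAdd.comp ((unSucc.comp hctx.snd'.fst').pair hctx.fst'.snd'.snd'.snd'.snd'.fst')))).congr fun p => by
      simp [noiseWidth]
  have hW : CodeFP (pairE hRecE (pairE (rawE itemRawE) strE)) unE (fun p => p.1.1.2.2.1 * noiseWidth p.1.2) := (unMul_codeFP.comp (hn.pair hWn) :)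
  have hm : CodeFP (pairE hRecE (pairE (rawE itemRawE) strE)) unE (fun p => p.2.1.length) := ((ulength _).comp hits :)
  have hchunks : CodeFP (pairE hRecE (pairE (rawE itemRawE) strE)) (rawE strE) (fun p => (List.range p.2.1.length).map fun i =>
      ((p.2.2.drop (min (p.1.1.2.2.1 * (p.1.1.2.2.2 * p.1.1.2.1)) p.2.2.length)).drop (i * (p.1.1.2.2.1 * noiseWidth p.1.2))).take (p.1.1.2.2.1 * noiseWidth p.1.2)) :=
    (strChunks.comp (hm.pair (hW.pair hrest)) :)
  -- the step: context `(record, cols)`, item `(it, ci)`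
  have hstep : CodeFP (pairE (pairE hRecE (rawE (rawE natE))) (pairE itemRawE strE)) itemRawE
      (fun t => hybT2Item t.1.1.1.1 t.1.2 t.2.1 (noiseOf t.1.1.2 t.1.1.1.2.2.1 t.2.2)) := by
    have hes : CodeFP (pairE (pairE hRecE (rawE (rawE natE))) (pairE itemRawE strE)) (rawE intE) (fun t => noiseOf t.1.1.2 t.1.1.1.2.2.1 t.2.2) :=
      (noiseOf_codeFP.comp (((fst _ _).fst'.snd'.pair (fst _ _).fst'.fst'.snd'.snd'.fst').pair (snd _ _).snd') :)
    exact (hybT2Item_codeFP.comp (((fst _ _).fst'.fst'.fst'.pair (fst _ _).snd').pair ((snd _ _).fst'.pair hes)) :)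
  exact (((zipWith hstep).comp ((hr.pair hcols).pair (hits.pair hchunks))).congr fun p => rfl)

end CodeFP

/-! ### The law on uniform coins -/

section Law

variable {Q : ℕ} [NeZero Q] {n k : ℕ}

/-- `dotModZ` on residue encodings is `ZMod.val` of `⟨col, a⟩ + ē`. [folklore] -/
theorem dotModZ_encT (col a : Fin k → ZMod Q) (e : ℤ) : dotModZ Q (encT col) (encT a) e = (col ⬝ᵥ a + (e : ZMod Q)).val := by
  unfold dotModZ
  rw [toNat_emod_eq_val (q := Q)]
  congr 1
  rw [encT, encT, zipWith_ofFn_ofFn, List.sum_ofFn, dotProduct]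
  push_cast
  congr 1
  refine Finset.sum_congr rfl fun j _ => ?_
  rw [ZMod.natCast_zmod_val, ZMod.natCast_zmod_val]

omit [NeZero Q] in
/-- The columns program reads only the first `n·kL` coins. [folklore] -/
theorem colsFlat_append_left (L : ℕ) {l₁ : List Bool} (l₂ : List Bool) (h : n * (k * L) ≤ l₁.length) :
    colsFlat Q L n k (l₁ ++ l₂) = colsFlat Q L n k l₁ := by
  unfold colsFlat
  congr 1
  refine List.map_congr_left fun j hj => ?_
  rw [List.mem_range] at hj
  have hjk : j * (k * L) + k * L ≤ n * (k * L) := by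
    have := Nat.mul_le_mul_right (k * L) (Nat.succ_le_of_lt hj)
    rwa [Nat.succ_mul] at this
  rw [List.drop_append_of_le_length (by omega), List.take_append_of_le_length (by rw [List.length_drop]; omega)]

/-- The columns of a word vector of length exactly `n·kL`, as `encT` of residue vectors. [folklore] -/
theorem colsFlat_eq_ofFn (L : ℕ) (v : List.Vector Bool (n * (k * L))) :
    colsFlat Q L n k v.toList = List.ofFn fun j => encT (shiftOfCoins Q L k (le_of_eq (Nat.mul_comm L k))
      (chunks (k * L) n (le_of_eq (Nat.mul_comm (k * L) n)) v j)) := by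
  simp only [colsFlat, chunkList_eq_ofFn, List.map_ofFn]
  congr 1
  funext j
  simp only [Function.comp_apply, wordsOf_eq_tFlat]
  exact tFlat_eq_encT (q := Q) (le_of_eq (Nat.mul_comm L k)) (chunks (k * L) n (le_of_eq (Nat.mul_comm (k * L) n)) v j)

/-- **The columns read off uniform coins are iid vectors of residues.** [cite: BrakerskiEtAl2013, Lemma 4.9 (proof, ℬ₂); AroraBarak2009, Def. 7.1] -/
theorem uniformVector_map_colsFlat (L : ℕ) {C : ℕ} (hC : n * (k * L) ≤ C) :
    (uniformOfFintype (List.Vector Bool C)).map (fun v => colsFlat Q L n k v.toList) =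
      (iidPMF (iidPMF (modLaw (2 ^ L) Q) k) n).map fun cols => List.ofFn fun j => encT (cols j) := by
  have hm : (k * L) * n ≤ C := by rw [Nat.mul_comm]; exact hC
  have hLk : L * k ≤ k * L := le_of_eq (Nat.mul_comm L k)
  have hfac : (fun v : List.Vector Bool C => colsFlat Q L n k v.toList) =
      (fun cols : Fin n → Fin k → ZMod Q => List.ofFn fun j => encT (cols j)) ∘ (fun c (j : Fin n) => shiftOfCoins Q L k hLk (c j)) ∘ chunks (k * L) n hm := by
    funext v
    simp only [Function.comp_apply, colsFlat, chunkList_eq_ofFn, List.map_ofFn]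
    congr 1
    funext j
    simp only [Function.comp_apply, wordsOf_eq_tFlat]
    exact tFlat_eq_encT (q := Q) hLk (chunks (k * L) n hm v j)
  rw [hfac, ← PMF.map_comp, ← PMF.map_comp, uniformVector_map_chunks_eq_indepLaw, indepLaw_map_pi n _ (fun _ => shiftOfCoins Q L k hLk)]
  simp_rw [uniformVector_map_shift]
  rw [indepLaw_const]

/-- **The noise coordinates read off a uniform chunk are iid `rejLaw`.** [cite: GentryPeikertVaikuntanathan2008, §4.1; AroraBarak2009, Def. 7.1] -/
theorem uniformVector_map_noiseFlat (θ : ℚ) (s N P w R : ℕ) {W : ℕ} (hW : n * (R * (w + 1 + P)) ≤ W) :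
    (uniformOfFintype (List.Vector Bool W)).map (fun v => noiseFlat θ s N P w R n v.toList) =
      (iidPMF (GaussRej.rejLaw θ 0 s N P w R) n).map fun es => List.ofFn es := by
  have hm : (R * (w + 1 + P)) * n ≤ W := by rw [Nat.mul_comm]; exact hW
  have hfac : (fun v : List.Vector Bool W => noiseFlat θ s N P w R n v.toList) =
      List.ofFn ∘ (fun c (j : Fin n) => rejFlat θ 0 s N P w R (c j).toList) ∘ chunks (R * (w + 1 + P)) n hm := by
    funext v
    simp only [Function.comp_apply, noiseFlat, chunkList_eq_ofFn, List.map_ofFn]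
    rfl
  rw [hfac, ← PMF.map_comp, ← PMF.map_comp, uniformVector_map_chunks_eq_indepLaw,
    indepLaw_map_pi n _ (fun (_ : Fin n) (c : List.Vector Bool (R * (w + 1 + P))) => rejFlat θ 0 s N P w R c.toList)]
  simp_rw [uniformVector_map_rejFlat θ 0 s N P w R le_rfl]
  rw [indepLaw_const]

/-- **One transformed item is `toItem (Cᵀa + ē, b)`.** [folklore] -/
theorem hybT2Item_eq_toItem (cols : Fin n → Fin k → ZMod Q) (x : (Fin k → ZMod Q) × ZMod Q) (es : Fin n → ℤ) :
    hybT2Item Q (List.ofFn fun j => encT (cols j)) (toItem x) (List.ofFn es) =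
      toItem (((fun j => cols j ⬝ᵥ x.1 + ((es j : ℤ) : ZMod Q)), x.2) : (Fin n → ZMod Q) × ZMod Q) := by
  unfold hybT2Item toItem
  simp only [Prod.mk.injEq, and_true, zipWith_ofFn_ofFn]
  congr 1
  funext j
  exact dotModZ_encT (cols j) x.1 (es j)

/-- **On uniform coins the program samples `machHybT2`** (read through `toItem`), for coin strings of length `C ≥ n·kL + M·n·R(w+1+P)`.
[cite: BrakerskiEtAl2013, Lemma 4.9 (proof, ℬ₂) and §5; AroraBarak2009, Def. 7.1] -/
theorem uniformVector_map_hybT2Flat (L : ℕ) (θ : ℚ) (s N P w R : ℕ) {M : ℕ} (S : Fin M → (Fin k → ZMod Q) × ZMod Q) {C : ℕ}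
    (hC : n * (k * L) + M * (n * (R * (w + 1 + P))) ≤ C) :
    (uniformOfFintype (List.Vector Bool C)).map (fun v => hybT2Flat Q L n k θ s N P w R (List.ofFn fun i => toItem (S i)) v.toList) =
      (machHybT2 (n := n) L θ s N P w R M S).map fun S' => List.ofFn fun i => toItem (S' i) := by
  classical
  set W := n * (R * (w + 1 + P)) with hWdef
  have h1 : n * (k * L) ≤ C := le_of_add_le_left hC
  have hm : W * M ≤ C - n * (k * L) := by rw [Nat.mul_comm]; omega
  set smp : (Fin n → Fin k → ZMod Q) → List.Vector Bool (C - n * (k * L)) → List LItem := fun cols v₂ =>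
    List.ofFn fun i : Fin M => hybT2Item Q (List.ofFn fun j => encT (cols j)) (toItem (S i)) (noiseFlat θ s N P w R n (chunks W M hm v₂ i).toList) with hsmp
  have hfac : (fun v : List.Vector Bool C => hybT2Flat Q L n k θ s N P w R (List.ofFn fun i => toItem (S i)) v.toList) =
      (fun pr : List.Vector Bool (n * (k * L)) × List.Vector Bool (C - n * (k * L)) =>
        smp ((fun c (j : Fin n) => shiftOfCoins Q L k (le_of_eq (Nat.mul_comm L k)) (c j)) (chunks (k * L) n (le_of_eq (Nat.mul_comm (k * L) n)) pr.1)) pr.2) ∘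
        vecSplit (n * (k * L)) C h1 := by
    funext v
    simp only [Function.comp_apply, vecSplit, Equiv.coe_fn_mk, hsmp]
    unfold hybT2Flat
    have hcols : colsFlat Q L n k v.toList = List.ofFn fun j => encT (shiftOfCoins Q L k (le_of_eq (Nat.mul_comm L k))
        (chunks (k * L) n (le_of_eq (Nat.mul_comm (k * L) n)) (⟨v.toList.take (n * (k * L)), by simp [h1]⟩ : List.Vector Bool (n * (k * L))) j)) := by
      rw [← colsFlat_eq_ofFn]
      conv_lhs => rw [← List.take_append_drop (n * (k * L)) v.toList]
      rw [colsFlat_append_left L _ (by rw [List.length_take, List.Vector.toList_length, min_eq_left h1])]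
      rfl
    simp only [hcols, List.length_ofFn, chunkList_eq_ofFn, zipWith_ofFn_ofFn, ← hWdef]
    rfl
  rw [hfac, ← PMF.map_comp, uniformVector_map_vecSplit, uniformOfFintype_prod_eq_bind, PMF.map_bind]
  simp only [PMF.map_comp, Function.comp_def]
  -- the columns
  have hcolsLaw : (uniformOfFintype (List.Vector Bool (n * (k * L)))).map (fun v₁ => fun j : Fin n =>
      shiftOfCoins Q L k (le_of_eq (Nat.mul_comm L k)) (chunks (k * L) n (le_of_eq (Nat.mul_comm (k * L) n)) v₁ j)) = iidPMF (iidPMF (modLaw (2 ^ L) Q) k) n := by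
    rw [show (fun v₁ : List.Vector Bool (n * (k * L)) => fun j : Fin n => shiftOfCoins Q L k (le_of_eq (Nat.mul_comm L k)) (chunks (k * L) n (le_of_eq (Nat.mul_comm (k * L) n)) v₁ j)) =
        (fun c (j : Fin n) => shiftOfCoins Q L k (le_of_eq (Nat.mul_comm L k)) (c j)) ∘ chunks (k * L) n (le_of_eq (Nat.mul_comm (k * L) n)) from rfl,
      ← PMF.map_comp, uniformVector_map_chunks_eq_indepLaw, indepLaw_map_pi n _ (fun _ => shiftOfCoins Q L k (le_of_eq (Nat.mul_comm L k)))]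
    simp_rw [uniformVector_map_shift]
    rw [indepLaw_const]
  -- the items given the columns
  have hsmpLaw : ∀ cols : Fin n → Fin k → ZMod Q, (uniformOfFintype (List.Vector Bool (C - n * (k * L)))).map (smp cols) =
      (indepLaw M fun i => (iidPMF (GaussRej.rejLaw θ 0 s N P w R) n).map fun es =>
        toItem (d := n) (Q := Q) ((fun j => cols j ⬝ᵥ (S i).1 + ((es j : ℤ) : ZMod Q)), (S i).2)).map List.ofFn := by
    intro cols
    have hf : smp cols = List.ofFn ∘ (fun c (i : Fin M) => hybT2Item Q (List.ofFn fun j => encT (cols j)) (toItem (S i)) (noiseFlat θ s N P w R n (c i).toList)) ∘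
        chunks W M hm := by
      funext v₂; rfl
    rw [hf, ← PMF.map_comp, ← PMF.map_comp, uniformVector_map_chunks_eq_indepLaw,
      indepLaw_map_pi M _ (fun (i : Fin M) (c : List.Vector Bool W) => hybT2Item Q (List.ofFn fun j => encT (cols j)) (toItem (S i)) (noiseFlat θ s N P w R n c.toList))]
    congr 2
    funext i
    rw [show (fun c : List.Vector Bool W => hybT2Item Q (List.ofFn fun j => encT (cols j)) (toItem (S i)) (noiseFlat θ s N P w R n c.toList)) =
        (fun l : List ℤ => hybT2Item Q (List.ofFn fun j => encT (cols j)) (toItem (S i)) l) ∘ (fun c : List.Vector Bool W => noiseFlat θ s N P w R n c.toList) from rfl,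
      ← PMF.map_comp, uniformVector_map_noiseFlat θ s N P w R (le_of_eq hWdef.symm), PMF.map_comp]
    congr 1
    funext es
    exact hybT2Item_eq_toItem cols (S i) es
  calc ((uniformOfFintype (List.Vector Bool (n * (k * L)))).bind fun v₁ => (uniformOfFintype (List.Vector Bool (C - n * (k * L)))).map fun v₂ =>
        smp (fun j : Fin n => shiftOfCoins Q L k (le_of_eq (Nat.mul_comm L k)) (chunks (k * L) n (le_of_eq (Nat.mul_comm (k * L) n)) v₁ j)) v₂)
      = ((uniformOfFintype (List.Vector Bool (n * (k * L)))).map fun v₁ => fun j : Fin n =>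
          shiftOfCoins Q L k (le_of_eq (Nat.mul_comm L k)) (chunks (k * L) n (le_of_eq (Nat.mul_comm (k * L) n)) v₁ j)).bind fun cols =>
          (uniformOfFintype (List.Vector Bool (C - n * (k * L)))).map (smp cols) := by rw [PMF.bind_map]; rfl
    _ = (iidPMF (iidPMF (modLaw (2 ^ L) Q) k) n).bind fun cols =>
          (indepLaw M fun i => (iidPMF (GaussRej.rejLaw θ 0 s N P w R) n).map fun es =>
            toItem (d := n) (Q := Q) ((fun j => cols j ⬝ᵥ (S i).1 + ((es j : ℤ) : ZMod Q)), (S i).2)).map List.ofFn := by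
        rw [hcolsLaw]
        congr 1
        funext cols
        exact hsmpLaw cols
    _ = (machHybT2 (n := n) L θ s N P w R M S).map fun S' => List.ofFn fun i => toItem (S' i) := by
        rw [machHybT2, PMF.map_bind]
        congr 1
        funext cols
        rw [PMF.map_comp, iidPMF_eq_indepLaw (iidPMF (GaussRej.rejLaw θ 0 s N P w R) n) M,
          ← indepLaw_map_pi M (fun _ => iidPMF (GaussRej.rejLaw θ 0 s N P w R) n)
            (fun i (e : Fin n → ℤ) => toItem (d := n) (Q := Q) ((fun j => cols j ⬝ᵥ (S i).1 + ((e j : ℤ) : ZMod Q)), (S i).2)),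
          PMF.map_comp]
        rfl

end Law

end KProg

end BLPRS2013

end Literature.Computability.Cryptography

end
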